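import Mathlib
import HarnessLib
import Literature.Analysis.FluidPDE.ClassicalSolution
import Literature.Analysis.FluidPDE.VectorCalculus
import Summits.NavierStokesRegularity.NavierStokesRegularity.Theses.UnthreadedRigidityDoor
import Summits.NavierStokesRegularity.NavierStokesRegularity.Theorems.UnthreadedRigidityDoorUnthreadedRigidityProfileHornShellZero
import Summits.NavierStokesRegularity.NavierStokesRegularity.Theorems.UnthreadedRigidityDoorUnthreadedRigidityProfileHornRigidity
import Summits.NavierStokesRegularity.NavierStokesRegularity.Theorems.UnthreadedRigidityDoorUnthreadedRigidityProfileHornZonalAxis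

/-!
# Route `UnthreadedRigidityDoor`, item `UnthreadedRigidity` (W2, stmt-NavierStokesRegularity-27585) — LINE g10-2 «PROFILE HORN»:
# the kernel-checked COMPOSITIONS BY NAME, with THEOREM PHR and S-Z discharged; the negative horn is DEAD in the kernel

Prover file (W2 Lean hand ns-crc-p1 g7, keyed by DIRECTOR-NS dss_128 / KEY-NS #184; `--supports stmt-NavierStokesRegularity-27585 --as helper`)
for LINE g10-2 «PROFILE HORN» of planner ns-idea-6 g10 on the wall item `UnthreadedRigidity` (route `UnthreadedRigidityDoor`, W2;
idea-crit-4 g6 PASS 2026-08-29T01:30:55Z; sketch `pub/ideators/ns-idea-6/lines/UnthreadedRigidityDoor/ProfileHorn_sketch.lean` sha16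
916bdf9b3eac7d48; objects and statements BY NAME in `Theorems/UnthreadedRigidityDoorUnthreadedRigidityProfileHornDefs.lean`).

The sketch's bookkeeping lemmas and its three compositions, VERBATIM against the tree objects (`separableShellOrderTwoRigidity_of_horn`:
PH ∧ PHR ∧ S-Z ⇒ the one-sided rung; `separableWindowRigidity_of_horn`: PH-W ∧ PHR ∧ S-Z ⇒ the window rung; `separableWindowRigidity_of_crux`:
the window rung is a restriction of the crux `Theses.UnthreadedRigidityDoor.UnthreadedRigidity`), the typed negative edge
`profileHornRoot_iff_not_rigidity`, and — new, from `profileHornRigidity_holds` (THEOREM PHR) and `zonalSepShellAxisymUniform_holds` (S-Z) —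
`not_profileHornRoot : ¬ ProfileHornRoot` (the `l = 2` negative horn is refuted in the kernel),
`separableShellOrderTwoRigidity_of_identity : HornIdentityTwo → SeparableShellOrderTwoRigidity` and
`separableWindowRigidity_of_silence : HornWindowSilence → SeparableWindowRigidity`: after this file each rung waits on exactly ONE M–L bridge
(PH `HornIdentityTwo`, resp. PH-W `HornWindowSilence`).

HONEST LABEL: one-dimensional real analysis about the radial profile of SPECIAL (separable `l = 2`) slice data; it is a piece of a LINE on
the wall item, not the item: `UnthreadedRigidity` (27585), W2 and NS regularity remain OPEN; nothing here is a statement about the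
Navier–Stokes equations.  0 kit.
-/

-- the summit and its single sub-problem share the name (CONVENTIONS §1), as in every Theorems file
set_option linter.dupNamespace false

namespace Summit.NavierStokesRegularity.NavierStokesRegularity.Theorems.UnthreadedRigidity.ProfileHorn

open scoped Topology
open Filter Set MeasureTheory

/-! ## Bookkeeping lemmas (proved) -/

/-- standard basis vectors. -/
noncomputable def e (i : Fin 3) : E3 := EuclideanSpace.single i (1 : ℝ)

/-- the infinitesimal rotation about `e 2` (verbatim g9). -/
noncomputable def rotZ : E3 →L[ℝ] E3 :=
  (innerSL ℝ (e 0)).smulRight (e 1) - (innerSL ℝ (e 1)).smulRight (e 0)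

/-- the generator `rotZ` in coordinates: `rotZ x = ⟪e₀, x⟫ e₁ − ⟪e₁, x⟫ e₀`. -/
lemma rotZ_apply (x : E3) : rotZ x = inner ℝ (e 0) x • e 1 - inner ℝ (e 1) x • e 0 := by
  simp [rotZ]

/-- `rotZ` is skew: `⟪rotZ x, x⟫ = 0`. -/
lemma rotZ_skew (x : E3) : inner ℝ (rotZ x) x = 0 := by
  rw [rotZ_apply, inner_sub_left, real_inner_smul_left, real_inner_smul_left]
  ring

/-- `rotZ ≠ 0`. -/
lemma rotZ_ne_zero : rotZ ≠ 0 := by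
  intro h
  have h1 := congrArg (fun A : E3 →L[ℝ] E3 => (A (e 0)) 1) h
  simp [rotZ_apply, e, EuclideanSpace.inner_single_left] at h1

/-- the zero field is «axisymmetric» about every point (any generator). -/
lemma isSliceAxisymmetric_zero (x₀ : E3) : IsSliceAxisymmetric (fun _ : E3 => (0 : E3)) x₀ := by
  refine ⟨rotZ, rotZ_skew, rotZ_ne_zero, fun x => ?_⟩
  simp

/-- a field that vanishes identically is axisymmetric. -/
lemma isSliceAxisymmetric_of_eq_zero {v : E3 → E3} (hv : ∀ x, v x = 0) (x₀ : E3) : IsSliceAxisymmetric v x₀ := by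
  have : v = fun _ => (0 : E3) := funext hv
  rw [this]; exact isSliceAxisymmetric_zero x₀

/-- non-zonal ⇒ a unit direction where the discriminant cubic is non-zero. -/
lemma exists_unit_discr_ne_zero {Q : Matrix (Fin 3) (Fin 3) ℝ} (hQ : ¬ IsZonalForm Q) :
    ∃ y : E3, ‖y‖ = 1 ∧ discrCubic Q y ≠ 0 := by
  simp only [IsZonalForm, not_forall] at hQ
  obtain ⟨y, hy, hD⟩ := hQ
  exact ⟨y, hy, hD⟩

/-- from the identity and a vanishing second jet in a non-degenerate direction: `K(r) · W̃(r) = 0`. -/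
lemma vortAmp_mul_hornBracket_eq_zero {K W D r : ℝ} (hr : 0 < r) (hD : D ≠ 0)
    (h : K * r ^ 3 * D * W = 0) : K * W = 0 := by
  have hr3 : r ^ 3 ≠ 0 := pow_ne_zero 3 hr.ne'
  rcases mul_eq_zero.mp h with h1 | h1
  · rcases mul_eq_zero.mp h1 with h2 | h2
    · rcases mul_eq_zero.mp h2 with h3 | h3
      · simp [h3]
      · exact absurd h3 hr3
    · exact absurd h2 hD
  · simp [h1]



/-! ## Compositions (kernel-checked) -/

/-- COMPOSITION 1: PH ∧ PHR ∧ S-Z ⇒ the one-sided rung, for EVERY admissible profile (S-0 is proved above). -/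
theorem separableShellOrderTwoRigidity_of_horn
    (hI : HornIdentityTwo) (hR : ProfileHornRigidity) (hZ : ZonalSepShellAxisymUniform) :
    SeparableShellOrderTwoRigidity := by
  intro t₀ T u p x₀ Q H hT hsol hp hQ hH hdat hj1 hj2
  by_cases hz : IsZonalForm Q
  · obtain ⟨A, hA, hA0, hAx⟩ := hZ Q hQ hz
    rw [hdat]
    exact ⟨A, hA, hA0, fun x => hAx H x₀ hH x⟩
  · obtain ⟨y₀, hy₀, hD⟩ := exists_unit_discr_ne_zero hz
    have hKW : ∀ r : ℝ, 0 < r → vortAmp H r * hornBracket H r = 0 := by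
      intro r hr
      have h1 := hI t₀ T u p x₀ Q H hT hsol hp hQ hH hdat r hr y₀ hy₀
      rw [hj2 (x₀ + r • y₀)] at h1
      exact vortAmp_mul_hornBracket_eq_zero hr hD h1.symm
    have hH0 : ∀ r : ℝ, 0 ≤ r → H r = 0 := hR H hH hKW
    rw [hdat]
    exact isSliceAxisymmetric_of_eq_zero (nullProfileShellZero_holds H Q x₀ hH0) x₀

/-- The negative horn is exactly the negation of PHR (typed negative edge; PHR is proved on paper, so `ProfileHornRoot` is refuted on paper). -/
theorem profileHornRoot_iff_not_rigidity : ProfileHornRoot ↔ ¬ ProfileHornRigidity := by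
  constructor
  · rintro ⟨H, hH, hKW, r, hr, hne⟩ hR
    exact hne (hR H hH hKW r hr)
  · intro h
    simp only [ProfileHornRigidity, not_forall] at h
    obtain ⟨H, hH, hKW, r, hr, hne⟩ := h
    exact ⟨H, hH, hKW, r, hr, hne⟩

/-! ## The window rung -/

/-- COMPOSITION 2: PH-W ∧ PHR ∧ S-Z ⇒ the window rung (27585 on separable `l = 2` windows; S-0 proved above). -/
theorem separableWindowRigidity_of_horn
    (hW : HornWindowSilence) (hR : ProfileHornRigidity) (hZ : ZonalSepShellAxisymUniform) :
    SeparableWindowRigidity := by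
  intro S hS hconn u x₀ hcont hdiv hmild hbdd hunth Q hQ hsep
  choose! Hf hHa hHu using hsep
  by_cases hz : IsZonalForm Q
  · obtain ⟨A, hA, hA0, hAx⟩ := hZ Q hQ hz
    refine ⟨A, hA, hA0, fun t ht x => ?_⟩
    rw [hHu t ht]
    exact hAx (Hf t) x₀ (hHa t ht) x
  · have key := hW S hS u x₀ hcont hdiv hmild hbdd Q Hf hQ (fun t ht => ⟨hHa t ht, hHu t ht⟩)
    refine ⟨rotZ, rotZ_skew, rotZ_ne_zero, fun t ht x => ?_⟩
    have hH0 : ∀ r : ℝ, 0 ≤ r → Hf t r = 0 := hR (Hf t) (hHa t ht) ((key t ht).resolve_left hz)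
    have hu0 : u t = fun _ => (0 : E3) := by
      rw [hHu t ht]; funext x'; exact nullProfileShellZero_holds (Hf t) Q x₀ hH0 x'
    rw [hu0]
    simp

/-- COMPOSITION 3 (bookkeeping): the window rung is implied by the crux itself (it is a restriction) — so it is a genuine rung BELOW 27585. -/
theorem separableWindowRigidity_of_crux
    (h : Summit.NavierStokesRegularity.NavierStokesRegularity.Theses.UnthreadedRigidityDoor.UnthreadedRigidity) :
    SeparableWindowRigidity := by
  intro S hS hconn u x₀ hcont hdiv hmild hbdd hunth Q hQ hsep
  exact h S hS hconn u x₀ hcont hdiv hmild hbdd hunth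

/-! ## With THEOREM PHR discharged -/

/-- THE NEGATIVE HORN IS DEAD (kernel): the horn equation has no admissible non-trivial root. -/
theorem not_profileHornRoot : ¬ ProfileHornRoot := fun hneg =>
  (profileHornRoot_iff_not_rigidity.mp hneg) profileHornRigidity_holds

/-- COMPOSITION 1 with PHR and S-Z discharged (S-0 proved): the BRIDGE PH alone gives the one-sided rung `SeparableShellOrderTwoRigidity`
(separable `l = 2` shells, EVERY admissible radial profile). -/
theorem separableShellOrderTwoRigidity_of_identity (hI : HornIdentityTwo) : SeparableShellOrderTwoRigidity :=
  separableShellOrderTwoRigidity_of_horn hI profileHornRigidity_holds zonalSepShellAxisymUniform_holds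

/-- COMPOSITION 2 with PHR and S-Z discharged: the BRIDGE PH-W alone gives the window rung `SeparableWindowRigidity`
(= the crux 27585 restricted to separable `l = 2` windows). -/
theorem separableWindowRigidity_of_silence (hW : HornWindowSilence) : SeparableWindowRigidity :=
  separableWindowRigidity_of_horn hW profileHornRigidity_holds zonalSepShellAxisymUniform_holds

end Summit.NavierStokesRegularity.NavierStokesRegularity.Theorems.UnthreadedRigidity.ProfileHorn
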